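import Literature.MathematicalPhysics.QuantumFieldTheory.BalabanImbrieJaffe1984to88.BIJ88Eq5128Split
import Mathlib.Analysis.SpecialFunctions.Gaussian.GaussianIntegral
import Mathlib.MeasureTheory.Integral.Pi
import Mathlib.MeasureTheory.Measure.Lebesgue.Complex

/-!
# `BalabanImbrieJaffe1984to88.BIJ88Eq5128WeightData` — T. Bałaban, J. Imbrie, A. Jaffe, *Effective action and cluster properties of the
abelian Higgs model*, Commun. Math. Phys. **114** (1988) 257–315 [BalabanImbrieJaffe1988], (5.12.7) p. 302 [PDF 46] / p. 300 [PDF 44] — **THE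
WEIGHT OF THE CONDITIONAL MEASURE `dμ^{(k)}_{Λ^{(k)}_{10}}` IS FIBRE-INTEGRABLE WHEN IT IS GAUSSIAN-DOMINATED (PROVED).**

statement-level skeleton of published theorems with citation tags; proofs where landed; nothing here is a claim about the Yang–Mills mass gap

THE PRINT.  p. 300 [PDF 44]: *"the integral in Λ^{(k)}_{10} is quite simple now. It involves a small, local, polynomial interaction V^{(k)} modifying
a Gaussian integral in φ^{(k)}, A^{(k)}. The inverse covariance is local and bounded from above and from below."*; (5.12.7) p. 302: *"we
normalize the remaining Gaussian measure in Λ^{(k)c*c}_{10}A^{(k)}, Λ^{(k)}_{10}φ^{(k)} and call it dμ^{(k)}_{Λ^{(k)}_{10}}(A^{(k)″}, φ^{(k)″})"*; §5.13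
p. 304: the measure *"𝒩′^{−1} dΦ|_{Λ^{(k)}_{10}} δ_{Ax,Λ^{(k)*}_{10}}(A^{(k)″}) exp[½⟨Φ, ΔΦ⟩ + ⟨Φ, ℱ⟩], Φ = (A^{(k)″}, φ^{(k)″})"* with the form
*"still bounded below"* (r16's `BIJ88Sect5Statements.claim304_lower`).

WHAT IS PROVED HERE (theorems only below the two Gaussian lemmas; 0 `sorry`; no `Prop`-valued fact; standard axioms).  The conditioning theorem of
this seat's `BIJ88Eq5128Frame.isDC_of_isDT` takes the weight `W` of the conditional measure with three data: jointly measurable, strictly positive,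
and INTEGRABLE OVER EACH INTERIOR FIBRE (`Interior.μInt m` = interior one-bond laws of mass one × Lebesgue on the interior sites `φ^{(k)″}|_{Λ^{(k)}_{10}}`).
This file discharges the shape of the third datum: §1 the Gaussian `e^{−c|z|²}` is integrable on `ℂ` and `e^{−cΣ_x|φ(x)|²}` on `ℂ^{Λ}` with the
product Lebesgue measure (Mathlib's one-dimensional Gaussian, `ℂ ≅ ℝ²`, finite products); §2 **`integrable_μInt_of_gaussian_bound`**: a
fibre function dominated by `C·e^{−cΣ_x|φ″(x)|²}`, `c > 0`, is integrable against `μInt` (the `u`-variables live on the compact `U(1)^{bonds}` with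
probability laws); §3 **`weight_fibre_integrable`**: hence a measurable weight on the configuration space with such a bound on every fibre — which
is what *"inverse covariance bounded from below"* gives for the Gaussian `exp[½⟨Φ, ΔΦ⟩ + ⟨Φ, ℱ⟩]` (`gaussian_bound_of_lower_bound`: a quadratic
form bounded below by `λ‖φ″‖²` plus a linear term is dominated by `e^{‖ℓ‖²/(2λ)}·e^{−(λ/2)‖φ″‖²}`) — satisfies the hypothesis `hWi` of
`isDC_of_isDT`.  HONEST SCOPE: the lower bound itself for the printed form (Δ^L_{k+1,loc}, (5.13.2)) is rows C2.Eq5.13.1-5.13.2 / C2.Eq5.4.7 content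
and is not re-derived here.
Seat p34 gen 10, file 6 (support of row C2.Eq5.12.8; own lineage).

CITATION HEADER (lean-in-tree rule).  Part of the lit-balaban TYPED SKELETON (HOME `run/shared/lean/pub/lit-balaban/`), PHASE-2 proof seat p34
gen 10 (unit `lit-balaban-p34-g10`).  Rows served: support of **`C2.Eq5.12.8`** (the weight data of the conditioning) and of `C2.Eq5.12.1-5.12.7`
((5.12.7)).  PDF held: `paper:balaban1988-cmp114-bij-abelian-higgs-effective-action` (journal page = PDF page + 256).  Imports this seat's
`BIJ88Eq5128Split` and Mathlib only.
-/

namespace Literature.MathematicalPhysics.QuantumFieldTheory.BalabanImbrieJaffe1984to88.BIJ88Eq5128WeightData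

open Literature.MathematicalPhysics.QuantumFieldTheory.Balaban1983to89
open BIJ88Sect3Statements (U1)
open BIJ85Sect1Model (HiggsField)
open BIJ88Eq5128Split (Cfg UCfg PCfg Interior)
open scoped BigOperators ENNReal
open _root_.MeasureTheory _root_.MeasureTheory.Measure Function Set

noncomputable section

-- As in `BIJ88Eq5128Split` (review note of p311866): the interior/exterior carriers `{x // x ∈ D.Ix} → ℂ` etc. are elaborated there with Mathlib's
-- `Subtype.fintype`; raising its priority file-locally makes `volume`/`Measure.pi` here use the same `Fintype` instance (instances are subsingletons).
attribute [local instance 1001] Subtype.fintype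

/-! ## §1 Gaussians on `ℂ` and on `ℂ^ι` with the product Lebesgue measure -/

section Gaussian

/-- `z ↦ e^{−c|z|²}` is Lebesgue-integrable on `ℂ` (`c > 0`): `ℂ ≅ ℝ × ℝ` measure-preservingly and the one-dimensional Gaussians are integrable.
[cite: BalabanImbrieJaffe1988, (5.12.7) p.302] -/
theorem integrable_exp_neg_mul_sq_norm_complex {c : ℝ} (hc : 0 < c) :
    Integrable (fun z : ℂ => Real.exp (-c * ‖z‖ ^ 2)) (volume : Measure ℂ) := by
  have h2 : Integrable (fun p : ℝ × ℝ => Real.exp (-c * p.1 ^ 2) * Real.exp (-c * p.2 ^ 2))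
      ((volume : Measure ℝ).prod (volume : Measure ℝ)) :=
    (integrable_exp_neg_mul_sq hc).mul_prod (integrable_exp_neg_mul_sq hc)
  have h3 := ((Complex.volume_preserving_equiv_real_prod).integrable_comp_emb
    Complex.measurableEquivRealProd.measurableEmbedding).mpr h2
  refine h3.congr (Filter.Eventually.of_forall fun z => ?_)
  simp only [Function.comp_apply, Complex.measurableEquivRealProd_apply]
  rw [← Real.exp_add, Complex.sq_norm, Complex.normSq_apply]
  congr 1
  ring

/-- `φ ↦ e^{−c Σ_x |φ(x)|²}` is integrable on `ℂ^ι` for the product Lebesgue measure (`c > 0`; a finite product of one-site Gaussians).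
[cite: BalabanImbrieJaffe1988, (5.12.7) p.302] -/
theorem integrable_exp_neg_mul_sum_sq_norm {ι : Type*} [Fintype ι] {c : ℝ} (hc : 0 < c) :
    Integrable (fun x : ι → ℂ => Real.exp (-c * ∑ j, ‖x j‖ ^ 2)) (Measure.pi fun _ : ι => (volume : Measure ℂ)) := by
  have h := Integrable.fintype_prod (μ := fun _ : ι => (volume : Measure ℂ)) (f := fun (_ : ι) (z : ℂ) => Real.exp (-c * ‖z‖ ^ 2))
    (fun _ => integrable_exp_neg_mul_sq_norm_complex hc)
  refine h.congr (Filter.Eventually.of_forall fun x => ?_)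
  simp only
  rw [← Real.exp_sum, Finset.mul_sum]

/-- **Completing the square**: a quadratic lower bound with a linear perturbation is Gaussian-dominated —
`λ > 0`, `q ≥ λ t²` ⟹ `e^{−q + b t} ≤ e^{b²/(2λ)} e^{−(λ/2) t²}` (used with `t = ‖φ″‖`, `q = −½⟨Φ,ΔΦ⟩`, `b t ≥ ⟨Φ,ℱ⟩`).
[cite: BalabanImbrieJaffe1988, (5.12.7) p.302] -/
theorem gaussian_bound_of_lower_bound {lam q b t : ℝ} (hlam : 0 < lam) (hq : lam * t ^ 2 ≤ q) :
    Real.exp (-q + b * t) ≤ Real.exp (b ^ 2 / (2 * lam)) * Real.exp (-(lam / 2) * t ^ 2) := by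
  rw [← Real.exp_add]
  refine Real.exp_le_exp.mpr ?_
  have h2 : 0 ≤ lam / 2 * (t - b / lam) ^ 2 := mul_nonneg (by positivity) (sq_nonneg _)
  have h3 : lam / 2 * (t - b / lam) ^ 2 = lam / 2 * t ^ 2 - b * t + b ^ 2 / (2 * lam) := by
    field_simp
    ring
  nlinarith [h2, h3, hq]

end Gaussian

/-! ## §2 The interior fibre of (5.12.8) -/

section Fibre

variable {P : Params} {k : ℕ}

/-- **A GAUSSIAN-DOMINATED FIBRE FUNCTION IS INTEGRABLE AGAINST THE INTERIOR MEASURE** `μInt m = du^{(k)}|_{int} ⊗ Π_{j<k}du^{(j)}|_{int} ⊗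
dφ^{(k)}|_{Λ^{(k)}_{10}}` (interior one-bond laws of mass one, Lebesgue on the interior sites): `‖F(i)‖ ≤ C e^{−cΣ_x|φ″(x)|²}`, `c > 0`, `F`
a.e.-strongly measurable ⟹ `F ∈ L¹(μInt)`. [cite: BalabanImbrieJaffe1988, (5.12.7) p.302] -/
theorem integrable_μInt_of_gaussian_bound (D : Interior P k) (m : PBond P k → Measure U1) [∀ b, IsProbabilityMeasure (m b)]
    {F : D.Int → ℝ} (hFm : AEStronglyMeasurable F (D.μInt m)) {C c : ℝ} (hc : 0 < c)
    (hF : ∀ i, ‖F i‖ ≤ C * Real.exp (-c * ∑ x, ‖i.2.2 x‖ ^ 2)) : Integrable F (D.μInt m) := by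
  have hG : Integrable (fun x : D.IX => C * Real.exp (-c * ∑ y, ‖x y‖ ^ 2)) (volume : Measure D.IX) :=
    (integrable_exp_neg_mul_sum_sq_norm hc).const_mul C
  have h1 : Integrable (fun z : D.IP × D.IX => (1 : ℝ) * (C * Real.exp (-c * ∑ y, ‖z.2 y‖ ^ 2))) (D.μIP.prod (volume : Measure D.IX)) :=
    (integrable_const (μ := D.μIP) (1 : ℝ)).mul_prod hG
  have h2 : Integrable (fun i : D.Int => (1 : ℝ) * ((1 : ℝ) * (C * Real.exp (-c * ∑ y, ‖i.2.2 y‖ ^ 2)))) (D.μInt m) := by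
    unfold Interior.μInt
    exact (integrable_const (μ := D.μIU m) (1 : ℝ)).mul_prod h1
  exact h2.mono' hFm (Filter.Eventually.of_forall fun i => by simpa only [one_mul] using hF i)

/-- **THE FIBRE-INTEGRABILITY DATUM `hWi` OF THE CONDITIONING (`BIJ88Eq5128Frame.isDC_of_isDT`) FOR A GAUSSIAN-DOMINATED WEIGHT**: a measurable
weight `W` on the configuration space with `|W| ≤ C(exterior) · e^{−cΣ_{x∈Λ^{(k)}_{10}}|φ^{(k)″}(x)|²}` on every interior fibre is integrable over
every fibre — the print's *"Gaussian integral in φ^{(k)}, A^{(k)} … inverse covariance bounded from below"* (with `gaussian_bound_of_lower_bound` for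
the linear term `⟨Φ, ℱ⟩`). [cite: BalabanImbrieJaffe1988, (5.12.7) p.302] -/
theorem weight_fibre_integrable (D : Interior P k) (m : PBond P k → Measure U1) [∀ b, IsProbabilityMeasure (m b)] {W : Cfg P k → ℝ}
    (hWm : Measurable W) {c : ℝ} (hc : 0 < c) (C : D.Ext → ℝ)
    (hW : ∀ (e : D.Ext) (i : D.Int), |W (D.glue e i)| ≤ C e * Real.exp (-c * ∑ x, ‖i.2.2 x‖ ^ 2)) (e : D.Ext) :
    Integrable (fun i => W (D.glue e i)) (D.μInt m) :=
  integrable_μInt_of_gaussian_bound D m (hWm.comp (D.measurableEmbedding_glue e).measurable).aestronglyMeasurable hc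
    fun i => by simpa only [Real.norm_eq_abs] using hW e i

/-- The same for a weight depending on spectator variables `(v′, ψ)` (the shape used in `isDC_of_isDT`: `W t q v′ ψ`).
[cite: BalabanImbrieJaffe1988, (5.12.7) p.302] -/
theorem weight_fibre_integrable_param {α : Type*} (D : Interior P k) (m : PBond P k → Measure U1) [∀ b, IsProbabilityMeasure (m b)]
    {W : Cfg P k → α → ℝ} (hWm : ∀ a, Measurable fun q => W q a) {c : ℝ} (hc : 0 < c) (C : D.Ext → α → ℝ)
    (hW : ∀ (e : D.Ext) (i : D.Int) (a : α), |W (D.glue e i) a| ≤ C e a * Real.exp (-c * ∑ x, ‖i.2.2 x‖ ^ 2)) (e : D.Ext) (a : α) :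
    Integrable (fun i => W (D.glue e i) a) (D.μInt m) :=
  weight_fibre_integrable D m (hWm a) hc (fun e' => C e' a) (fun e' i => hW e' i a) e

end Fibre

end

end Literature.MathematicalPhysics.QuantumFieldTheory.BalabanImbrieJaffe1984to88.BIJ88Eq5128WeightData
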